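import Summits.RiemannHypothesis.RiemannHypothesis.Theorems.MotivicDoorFunctionFieldMiddle
import Summits.RiemannHypothesis.RiemannHypothesis.Theorems.MotivicDoorFunctionFieldSigned
import Literature.AlgebraicGeometry.Motives.AbelianVarietyTateSimpleCharpoly

/-!
# The function-field door, part 9: parity of the admissible exponents and the sign of `P_A(0)`

FF-DOOR statement (ii), caveat (1) "powers", refined.  HONEST FRAMING (verbatim, binding): lottery ticket
at the motivic door; RH probability negligible; consolation prizes are real: a new semi-local
Weil-positivity theorem, or a located gap in the Connes–Consani programme, plus the ff-door theorem.

The signed door theorem (part 8, `signedDoor_abelianVariety`) realises every RH-true monic `h` of positive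
degree as `h ^ E = P_C` for SOME `E ≥ 1`, including data no actual `P_A` can equal: odd degree
(`(s², x - s)`) and negative constant term (`(q, x² - q)`).  This file records what that costs in `E`.

* [PROVED, fact-free] `deg P_C = 2 dim C` (`IsFrobCharpoly.natDegree_eq_two_mul_dim`), so
  `E · deg h` is even for every admissible exponent (`even_mul_natDegree_of_geometric_pow`); a datum of
  ODD degree has only EVEN admissible exponents (`even_of_geometric_pow_of_odd_natDegree`), e.g. `x - s`
  (`even_of_geometric_pow_X_sub_C`).
* [PROVED, conditional on the explicit hypothesis `(P0)`] `(P0) : P_A(0) > 0` for `dim A > 0` — in print as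
  "`P_α(X) = X^{2g} - Tr(α) X^{2g-1} + ⋯ + deg(α)`" (Milne, *Abelian varieties* §12, in Cornell–Silverman
  p. 125, with Prop. 12.9: `P_α` is the `ℓ`-adic characteristic polynomial) applied to the isogeny
  `α = π_A`.  It is NOT vendored as a Literature named fact (no held page states `deg π_A = q^{dim A}`
  verbatim); it is a hypothesis of the theorems below and of nothing else.  Under `(P0)`: a datum with
  `h(0) < 0` has only EVEN admissible exponents (`even_of_geometric_pow_of_coeff_zero_neg`), e.g. `x² - q`
  (`even_of_geometric_pow_X_sq_sub_C`); under `(W) + (P0)` every `P_A` has `P_A(0) = q^{dim A}`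
  (`coeff_zero_eq_of_isFrobCharpoly`) and satisfies the honest functional equation
  `q^{dim A} c_j = q^i c_i` (`fe_of_isFrobCharpoly`) — so the honesty hypothesis of the original door
  theorem is exactly right for `E = 1`, and the signed door's extra data are the `E`-even artefacts.
* [DATA, not used] `E = 2` is attained: `(x - 2)² = P_C` for a supersingular elliptic curve over `𝔽₄`,
  `(x² - 2)² = P_C` for a simple supersingular abelian surface over `𝔽₂` (LMFDB labels not vendored).
-/

open Polynomial
open Literature.AlgebraicGeometry.Motives

namespace Summit.RiemannHypothesis.RiemannHypothesis.Theorems.MotivicDoor.FunctionField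

set_option linter.dupNamespace false

universe u

variable {K : Type u} [Field K] [Finite K]

/-! ## Parity from the degree (fact-free) -/

/-- `h ^ E = P_C` forces `E · deg h = 2 dim C` to be even. [PROVED, fact-free] -/
theorem even_mul_natDegree_of_geometric_pow {h : ℤ[X]} (hh : h.Monic) {E : ℕ} {C : AbelianVariety K}
    (hC : C.IsFrobCharpoly (h ^ E)) : Even (E * h.natDegree) := by
  have h1 : (h ^ E).natDegree = 2 * C.dim := hC.natDegree_eq_two_mul_dim
  rw [hh.natDegree_pow] at h1
  exact ⟨C.dim, by omega⟩

/-- A datum of ODD degree has only EVEN admissible exponents. [PROVED, fact-free] -/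
theorem even_of_geometric_pow_of_odd_natDegree {h : ℤ[X]} (hh : h.Monic) (hodd : Odd h.natDegree)
    {E : ℕ} {C : AbelianVariety K} (hC : C.IsFrobCharpoly (h ^ E)) : Even E := by
  have := even_mul_natDegree_of_geometric_pow hh hC
  rcases Nat.even_mul.mp this with hE | hd
  · exact hE
  · exact absurd hd (Nat.not_even_iff_odd.mpr hodd)

/-- Instance: `(x - s) ^ E = P_C` forces `E` even. [PROVED, fact-free] -/
theorem even_of_geometric_pow_X_sub_C (s : ℤ) {E : ℕ} {C : AbelianVariety K}
    (hC : C.IsFrobCharpoly ((X - Polynomial.C s) ^ E)) : Even E :=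
  even_of_geometric_pow_of_odd_natDegree (monic_X_sub_C s) (by rw [natDegree_X_sub_C]; exact odd_one) hC

/-! ## Parity from the sign, under the explicit hypothesis `(P0)` -/

/-- The constant coefficient of a power. [PROVED] -/
theorem coeff_zero_pow_eq (h : ℤ[X]) (E : ℕ) : (h ^ E).coeff 0 = h.coeff 0 ^ E := by
  rw [coeff_zero_eq_eval_zero, eval_pow, ← coeff_zero_eq_eval_zero]

/-- Under `(P0)` (`P_A(0) > 0` for `dim A > 0`, an explicit hypothesis — see the module docstring): a monic
datum of positive degree with NEGATIVE constant term has only EVEN admissible exponents, because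
`(h ^ E)(0) = h(0) ^ E`. [PROVED, conditional on `(P0)`] -/
theorem even_of_geometric_pow_of_coeff_zero_neg
    (hP0 : ∀ (A : AbelianVariety K) (P : ℤ[X]), 0 < A.dim → A.IsFrobCharpoly P → 0 < P.coeff 0)
    {h : ℤ[X]} (hh : h.Monic) (hdeg : 0 < h.natDegree) (hneg : h.coeff 0 < 0) {E : ℕ} (hE : 0 < E)
    {C : AbelianVariety K} (hC : C.IsFrobCharpoly (h ^ E)) : Even E := by
  have hdim : 0 < C.dim := hC.dim_pos (by rw [hh.natDegree_pow]; exact Nat.mul_pos hE hdeg)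
  have hpos := hP0 C _ hdim hC
  rw [coeff_zero_pow_eq] at hpos
  rcases Nat.even_or_odd E with hEven | hOdd
  · exact hEven
  · exact absurd hpos (not_lt.mpr (hOdd.pow_neg hneg).le)

/-- Instance: under `(P0)`, `(x² - q) ^ E = P_C` over `#K = q` forces `E` even (`q ≥ 2`).
[PROVED, conditional on `(P0)`] -/
theorem even_of_geometric_pow_X_sq_sub_C
    (hP0 : ∀ (A : AbelianVariety K) (P : ℤ[X]), 0 < A.dim → A.IsFrobCharpoly P → 0 < P.coeff 0)
    {E : ℕ} (hE : 0 < E) {C : AbelianVariety K}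
    (hC : C.IsFrobCharpoly ((X ^ 2 - Polynomial.C (Nat.card K : ℤ)) ^ E)) : Even E := by
  obtain ⟨hm, hdeg, hc0, -⟩ := X_sq_sub_C_shape (Nat.card K : ℤ)
  refine even_of_geometric_pow_of_coeff_zero_neg hP0 hm (by rw [hdeg]; norm_num) ?_ hE hC
  rw [hc0, neg_lt_zero]
  exact_mod_cast (Nat.card_pos (α := K))

/-! ## Under `(W) + (P0)`: every `P_A` is honest -/

/-- Under `(W)` and `(P0)`: `P_A(0) = q ^ dim A`.  From the signed functional equation of `P_A`
(`twistedFE_of_geometric_pow` with `E = 1`): `P_A(0)² = q^{2 dim A}`, and `(P0)` picks the sign.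
[PROVED from hW and the explicit hypothesis (P0)] -/
theorem coeff_zero_eq_of_isFrobCharpoly (hW : ∀ A : AbelianVariety K, A.weilRiemannHypothesis)
    (hP0 : ∀ (A : AbelianVariety K) (P : ℤ[X]), 0 < A.dim → A.IsFrobCharpoly P → 0 < P.coeff 0)
    {A : AbelianVariety K} (hA : 0 < A.dim) {P : ℤ[X]} (hP : A.IsFrobCharpoly P) :
    P.coeff 0 = (Nat.card K : ℤ) ^ A.dim := by
  have hm : P.Monic := hP.monic
  have hdeg : P.natDegree = 2 * A.dim := hP.natDegree_eq_two_mul_dim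
  have hP1 : A.IsFrobCharpoly (P ^ 1) := by rwa [pow_one]
  have htw := twistedFE_of_geometric_pow hW hm one_pos hP1
  have hsq0 := coeff_zero_sq_eq_of_twistedFE hm rfl htw
  have hsq : P.coeff 0 ^ 2 = ((Nat.card K : ℤ) ^ A.dim) ^ 2 := by
    rw [hsq0, hdeg, ← pow_mul, mul_comm]
  have hpos : 0 < P.coeff 0 := hP0 A P hA hP
  have hqpos : (0 : ℤ) < (Nat.card K : ℤ) ^ A.dim := pow_pos (by exact_mod_cast (Nat.card_pos (α := K))) _
  rcases sq_eq_sq' hsq with hP | hP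
  · exact absurd hpos (not_lt.mpr (by rw [hP]; exact (neg_neg_of_pos hqpos).le))
  · exact hP
  where
  /-- `a² = b²` over `ℤ` gives `a = -b ∨ a = b`. [PROVED] -/
  sq_eq_sq' {a b : ℤ} (hab : a ^ 2 = b ^ 2) : a = -b ∨ a = b := by
    have := sq_eq_sq_iff_eq_or_eq_neg.mp hab
    tauto

/-- Under `(W)` and `(P0)`: every characteristic polynomial of Frobenius `P_A` (`dim A > 0`) satisfies the
HONEST functional equation `q^{dim A} c_j = q^i c_i` (`i + j = 2 dim A`) — i.e. `(q, P_A)` is an honest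
datum of dimension `dim A`, and the honesty hypothesis of the original door theorem is exactly right for
`E = 1`. [PROVED from hW and the explicit hypothesis (P0)] -/
theorem fe_of_isFrobCharpoly (hW : ∀ A : AbelianVariety K, A.weilRiemannHypothesis)
    (hP0 : ∀ (A : AbelianVariety K) (P : ℤ[X]), 0 < A.dim → A.IsFrobCharpoly P → 0 < P.coeff 0)
    {A : AbelianVariety K} (hA : 0 < A.dim) {P : ℤ[X]} (hP : A.IsFrobCharpoly P) :
    ∀ i j, i + j = 2 * A.dim → (Nat.card K : ℤ) ^ A.dim * P.coeff j = (Nat.card K : ℤ) ^ i * P.coeff i := by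
  have hm : P.Monic := hP.monic
  have hdeg : P.natDegree = 2 * A.dim := hP.natDegree_eq_two_mul_dim
  have hP1 : A.IsFrobCharpoly (P ^ 1) := by rwa [pow_one]
  have htw := twistedFE_of_geometric_pow hW hm one_pos hP1
  rw [hdeg, coeff_zero_eq_of_isFrobCharpoly hW hP0 hA hP] at htw
  exact htw

/-- Under `(W)` and `(P0)`: a monic datum of even degree `2g` with the "wrong" sign `h(0) = -q^g` is never
itself a `P_A` — only its even powers can be (`even_of_geometric_pow_of_coeff_zero_neg`).
[PROVED from hW and the explicit hypothesis (P0)] -/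
theorem not_isFrobCharpoly_of_coeff_zero_eq_neg (hW : ∀ A : AbelianVariety K, A.weilRiemannHypothesis)
    (hP0 : ∀ (A : AbelianVariety K) (P : ℤ[X]), 0 < A.dim → A.IsFrobCharpoly P → 0 < P.coeff 0)
    {h : ℤ[X]} {g : ℕ} (hg : 0 < g) (hdeg : h.natDegree = 2 * g)
    (hneg : h.coeff 0 = -((Nat.card K : ℤ) ^ g)) (A : AbelianVariety K) : ¬ A.IsFrobCharpoly h := by
  intro hA
  have hdim : 0 < A.dim := hA.dim_pos (by omega)
  have hg' : g = A.dim := by have := hA.natDegree_eq_two_mul_dim; omega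
  have := coeff_zero_eq_of_isFrobCharpoly hW hP0 hdim hA
  rw [hneg, ← hg'] at this
  have hqpos : (0 : ℤ) < (Nat.card K : ℤ) ^ g := pow_pos (by exact_mod_cast (Nat.card_pos (α := K))) _
  linarith

end Summit.RiemannHypothesis.RiemannHypothesis.Theorems.MotivicDoor.FunctionField
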